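import Summits.BirchSwinnertonDyer.BirchSwinnertonDyer.Theses.CongruentShaFreeCut
import Summits.BirchSwinnertonDyer.BirchSwinnertonDyer.Theorems.CongruentShaFreeCutLeafConverse
import Literature.NumberTheory.EllipticCurves.FanWan2023.NonsplitPConverseClaims
import Literature.NumberTheory.EllipticCurves.BSDWave0ContinuationProofs
import Literature.NumberTheory.EllipticCurves.BSDInvariantsProofs
import Literature.NumberTheory.EllipticCurves.LeadingTermProofs

/-! # Route `CongruentShaFreeCut` (rung S2) — crux `RankPosOfTwoSelmerCorankOne`
(stmt-BirchSwinnertonDyer-19079, the route's declared RESIDUAL conjunct): the Fan–Wan road at the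
CM field `ℚ(i)` — the conditional closure from the typed Fan–Wan claim, and the `ℚ(i)`-descent that
makes the `fw-ramified-tower` line for crux A honest

Crux A: `∀ n ≠ 0, corank_{ℤ₂} Sel_{2^∞}(E_n/ℚ) = 1 ⟹ rank E_n(ℚ) ≥ 1` for `E_n : y² = x³ − n²x`
(CM by `ℤ[i]`, `2 = −i(1+i)²` the RAMIFIED CM prime, additive reduction).

§1 THE TRANSFER ROAD, LEDGER FACE (conditional results; nothing open is asserted). The typer seat
landed Fan–Wan arXiv:2304.09806v2 Thm 1.1 as the OPEN CLAIM
`FanWan2023.thmM_analyticRank_eq_one_of_selmerCorank_eq_one_CLAIMED` ([claim: FanWan2023,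
status: under-review]; cell verdict: as PRINTED, GAP-LOCALISED; as COMPLETED by the cell's repair
bundle MEMO-transfer-1..8, NO-RESEARCH-GRADE-GAP-AT-DEPTH (two-read) at the cell scope modulo the
named residuals (R1-a/b/c/d)(R2)(R5), VERDICT Part IX §4 / IX-D §3). Granted that claim AND
Gross–Zagier–Kolyvagin (`rank_eq_analyticRank_of_analyticRank_le_one`, refereed named fact), crux A
holds: `rankPosOfTwoSelmerCorankOne_of_thmM_CLAIMED_of_gzk` — through the rung-leaf
(`FanWan2023.rankOne_twoConverse_congruentNumber_of_thmM_CLAIMED`) and the route's own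
`CongruentShaFreeCutLeafConverse.leaf_iff_cruxes_of_gzk`. Twins from Thm 6.9 + `2`-parity and from
Kříž's claimed Thm 10.13. These are `conditional-result`s: the item stays OPEN and RESIDUAL.

§2 THE `ℚ(i)`-DESCENT (tree theorems only; the closable companion stub of the crux-A line
`fw-ramified-tower`). Fan–Wan's mechanism (Rubin-type main conjecture Thm 5.18 + `p`-adic Waldspurger
Thm 4.2/4.4 + Prop \ref{Int} + the Perrin-Riou length argument of Thm 6.9 + the virtual Heegner
family §6.3/App. B) produces, from corank one, a NON-TORSION `ℚ(i)`-RATIONAL class on `E_n` BEFORE any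
appeal to Gross–Zagier; the step from a point over `K = ℚ(i)` to a point over `ℚ` is elementary and
is proved here: `rank E_n(ℚ(i)) = 2 · rank E_n(ℚ)` (`mordellWeilRank_baseChange_gaussianField`),
because `rank E(K) = rank E(ℚ) + rank E^{(d_K)}(ℚ)` (tree theorem
`mordellWeilRank_baseChange_quadratic_holds`, Silverman AEC Ex. 10.16), `E_n^{(−4)} = E_{4n}` as
Weierstrass models (`quadraticTwist_congruentNumberCurve`) and `E_{4n} ≅ E_n` over `ℚ`
(`congruentNumberCurve_sq_mul` with `b = 2`, rank invariant under the change of variables,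
`mordellWeilRank_variableChange_holds`). Hence `1 ≤ rank E_n(ℚ(i)) ↔ 1 ≤ rank E_n(ℚ)`
(`one_le_mordellWeilRank_iff_baseChange_gaussianField`), for EVERY `n ≠ 0`.

Supports, does not close, stmt-BirchSwinnertonDyer-19079. PARTITION: none (RANK axis). -/

namespace Summit.BirchSwinnertonDyer.BirchSwinnertonDyer.Theorems.CongruentShaFreeCutFanWanRoad

open Literature.NumberTheory.EllipticCurves WeierstrassCurve
open Summit.BirchSwinnertonDyer.BirchSwinnertonDyer.Theses.CongruentShaFreeCut

/-! ### §1. Crux A granted Fan–Wan's typed claim (conditional results) -/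

/-- **Crux A from Fan–Wan v2 Thm 1.1 (typed OPEN CLAIM) + Gross–Zagier–Kolyvagin.** Granted
`FanWan2023.thmM_analyticRank_eq_one_of_selmerCorank_eq_one_CLAIMED` (UNREFEREED; the cell's repair
bundle is its completion text at the cell data, VERDICT IX §4) and the refereed fact
`rank_eq_analyticRank_of_analyticRank_le_one`, the Ш-freeness half of the `2`-converse holds for every
`E_n`. CONDITIONAL RESULT — records the transfer road on the ledger; proves nothing unconditionally.
[claim: FanWan2023, status: under-review] [cite: Darmon2004, Thm. 3.22] -/
theorem rankPosOfTwoSelmerCorankOne_of_thmM_CLAIMED_of_gzk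
    (hFW : FanWan2023.thmM_analyticRank_eq_one_of_selmerCorank_eq_one_CLAIMED)
    (hGZK : rank_eq_analyticRank_of_analyticRank_le_one) : RankPosOfTwoSelmerCorankOne :=
  ((CongruentShaFreeCutLeafConverse.leaf_iff_cruxes_of_gzk hGZK).1
    (FanWan2023.rankOne_twoConverse_congruentNumber_of_thmM_CLAIMED hFW)).1

/-- **Crux A from Fan–Wan v2 Thm 6.9 (typed OPEN CLAIM, non-split `p`, sign `−1`) + the `2`-parity
theorem (Dokchitser–Dokchitser 2010, refereed fact `p_parity`) + Gross–Zagier–Kolyvagin.**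
CONDITIONAL RESULT. [claim: FanWan2023, status: under-review]
[cite: DokchitserDokchitserAnnals2010, Thm. 1.4] [cite: Darmon2004, Thm. 3.22] -/
theorem rankPosOfTwoSelmerCorankOne_of_thm69_CLAIMED_of_parity_of_gzk
    (h69 : FanWan2023.thm69_analyticRank_eq_one_of_selmerCorank_eq_one_of_not_cmSplit_CLAIMED)
    (hpar : ∀ (W : WeierstrassCurve ℚ) [W.IsElliptic] (p : ℕ) [Fact p.Prime], p_parity W p)
    (hGZK : rank_eq_analyticRank_of_analyticRank_le_one) : RankPosOfTwoSelmerCorankOne :=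
  ((CongruentShaFreeCutLeafConverse.leaf_iff_cruxes_of_gzk hGZK).1
    (FanWan2023.rankOne_twoConverse_congruentNumber_of_thm69_CLAIMED_of_parity h69 hpar)).1

/-- **Crux A from Kříž's claimed Thm 10.13 (arXiv:2002.04767v5, UNREFEREED, cell verdict
GAP-LOCALISED) + Gross–Zagier–Kolyvagin** — the other claimed proof; CONDITIONAL RESULT, recorded for
symmetry with the Fan–Wan road. [cite: Kriz2020, Thm. 10.13 of v5] [cite: Darmon2004, Thm. 3.22] -/
theorem rankPosOfTwoSelmerCorankOne_of_kriz_claim_of_gzk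
    (hK : kriz_analyticRank_eq_one_of_selmerCorank_eq_one_of_cmRamified)
    (hGZK : rank_eq_analyticRank_of_analyticRank_le_one) : RankPosOfTwoSelmerCorankOne :=
  ((CongruentShaFreeCutLeafConverse.leaf_iff_cruxes_of_gzk hGZK).1
    (rankOne_twoConverse_congruentNumber_of_cmRamified hK)).1

/-! ### §2. The CM field `ℚ(i)`: `E_n^{(−4)} = E_{4n} ≅ E_n`, rank doubling, descent -/

/-- **`E_n^{(d)} = E_{|d| n}` as Weierstrass models**: the tree's quadratic twist
`y² = x³ + d(b₂/4)x² + d²(b₄/2)x + d³(b₆/4)` of `y² = x³ − n²x` by an integer `d` is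
`y² = x³ − (dn)²x`. [folklore] -/
theorem quadraticTwist_congruentNumberCurve (n : ℕ) (d : ℤ) :
    (congruentNumberCurve n).quadraticTwist (d : ℚ) = congruentNumberCurve (d.natAbs * n) := by
  have hd : ((d.natAbs : ℕ) : ℚ) ^ 2 = (d : ℚ) ^ 2 := by
    rw [Nat.cast_natAbs, Int.cast_abs, sq_abs]
  ext
  · rfl
  · simp [quadraticTwist, congruentNumberCurve, WeierstrassCurve.b₂]
  · rfl
  · simp only [quadraticTwist, congruentNumberCurve, WeierstrassCurve.b₄, Nat.cast_mul, mul_pow, ← hd]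
    ring
  · simp [quadraticTwist, congruentNumberCurve, WeierstrassCurve.b₆]

/-- **`rank E_{4n}(ℚ) = rank E_n(ℚ)`**: `E_{4n} = E_{2²·n}` is an admissible change of variables of
`E_n` (`congruentNumberCurve_sq_mul`), and the Mordell–Weil rank is invariant
(`mordellWeilRank_variableChange_holds`, Silverman AEC III.3.1(b)). [cite: SilvermanAEC2009, III.3.1(b)] -/
theorem mordellWeilRank_congruentNumberCurve_four_mul (n : ℕ) :
    (congruentNumberCurve (4 * n)).mordellWeilRank = (congruentNumberCurve n).mordellWeilRank := by
  rw [show 4 * n = 2 ^ 2 * n by norm_num, congruentNumberCurve_sq_mul n two_ne_zero]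
  exact mordellWeilRank_variableChange_holds _ _

/-- **Rank doubling over the CM field: `rank E_n(ℚ(i)) = 2 · rank E_n(ℚ)`** for every `n ≠ 0` and
every number field `K` with `[K : ℚ] = 2` and `d_K = −4` (i.e. `K ≅ ℚ(i)`): `rank E_n(K) =
rank E_n(ℚ) + rank E_n^{(−4)}(ℚ)` (`mordellWeilRank_baseChange_quadratic_holds`) and
`E_n^{(−4)} = E_{4n} ≅ E_n`. [cite: SilvermanAEC2009, Exercise 10.16] -/
theorem mordellWeilRank_baseChange_gaussianField {n : ℕ} (hn : n ≠ 0) (K : Type) [Field K]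
    [NumberField K] (hK : Module.finrank ℚ K = 2) (hd : NumberField.discr K = -4) :
    ((congruentNumberCurve n).baseChange K).mordellWeilRank =
      2 * (congruentNumberCurve n).mordellWeilRank := by
  haveI := isElliptic_congruentNumberCurve hn
  rw [mordellWeilRank_baseChange_quadratic_holds (congruentNumberCurve n) K hK, hd,
    quadraticTwist_congruentNumberCurve n (-4), show Int.natAbs (-4) = 4 from rfl,
    mordellWeilRank_congruentNumberCurve_four_mul, two_mul]

/-- **Descent from `ℚ(i)`: `1 ≤ rank E_n(ℚ) ↔ 1 ≤ rank E_n(ℚ(i))`** (`n ≠ 0`, `K` any number field with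
`[K : ℚ] = 2`, `d_K = −4`). This is the closable companion stub (`stub_descentFromGaussianField`) of
the crux-A line `fw-ramified-tower`: Fan–Wan's mechanism outputs a non-torsion `ℚ(i)`-rational
class on `E_n`; this lemma brings it down to `ℚ`. [cite: SilvermanAEC2009, Exercise 10.16] -/
theorem one_le_mordellWeilRank_iff_baseChange_gaussianField {n : ℕ} (hn : n ≠ 0) (K : Type)
    [Field K] [NumberField K] (hK : Module.finrank ℚ K = 2) (hd : NumberField.discr K = -4) :
    1 ≤ (congruentNumberCurve n).mordellWeilRank ↔
      1 ≤ ((congruentNumberCurve n).baseChange K).mordellWeilRank := by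
  rw [mordellWeilRank_baseChange_gaussianField hn K hK hd]
  omega

/-- **`stub_descentFromGaussianField`-shaped statement, proved**: for every `n ≠ 0` and every
imaginary quadratic `K` with `d_K = −4`, a point of infinite order in `E_n(K)` yields one in
`E_n(ℚ)` (`rank E_n(K) ≥ 1 ⟹ rank E_n(ℚ) ≥ 1`). [cite: SilvermanAEC2009, Exercise 10.16] -/
theorem one_le_mordellWeilRank_of_baseChange_gaussianField :
    ∀ ⦃n : ℕ⦄, n ≠ 0 → ∀ (K : Type) [Field K] [NumberField K], IsImaginaryQuadratic K →
      NumberField.discr K = -4 → 1 ≤ ((congruentNumberCurve n).baseChange K).mordellWeilRank →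
        1 ≤ (congruentNumberCurve n).mordellWeilRank :=
  fun _ hn K _ _ hK hd h => (one_le_mordellWeilRank_iff_baseChange_gaussianField hn K hK.1 hd).2 h

/-- **Conversely crux A implies its `ℚ(i)`-level form** (so the research stub of the
`fw-ramified-tower` line — corank one ⟹ a `ℚ(i)`-point of infinite order — is EQUIVALENT to crux A
modulo this file: a last-step formulation, like every faithful one; the content strictly below A
appears only when the research stub is split over a typed `2`-adic `L`-function, Fan–Wan Prop
\ref{Int} / Thm 4.4 / Thm 5.18). [cite: SilvermanAEC2009, Exercise 10.16] -/
theorem one_le_mordellWeilRank_baseChange_gaussianField_of_crux (hA : RankPosOfTwoSelmerCorankOne) :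
    ∀ ⦃n : ℕ⦄, n ≠ 0 → (congruentNumberCurve n).selmerCorank 2 = 1 →
      ∀ (K : Type) [Field K] [NumberField K], IsImaginaryQuadratic K → NumberField.discr K = -4 →
        1 ≤ ((congruentNumberCurve n).baseChange K).mordellWeilRank :=
  fun _ hn hc K _ _ hK hd =>
    (one_le_mordellWeilRank_iff_baseChange_gaussianField hn K hK.1 hd).1 (hA hn hc)

end Summit.BirchSwinnertonDyer.BirchSwinnertonDyer.Theorems.CongruentShaFreeCutFanWanRoad
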